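import Summits.CriticalPhenomena.PercolationContinuityZ3.Theses.PercExchangeRateTransport

/-!
# `Lines/birth.lean` — birth skeleton for crux `PercExchangeRateTransport.CurveInvariance`
(item stmt-CriticalPhenomena-16068 · route route-CriticalPhenomena-PercExchangeRateTransport ·
sub-problem `PercolationContinuityZ3` · skeleton-register by
planner-skel-stmt-CriticalPhenomena-16068-0, 2026-08-17)

**Crux (ledger rank 9; the sixth binder `hCI` of the route's crux-only `closes`).**
`CurveInvariance`: with `θ(p,t)`, `pc t = sInf ({p | 0 ≤ p ≤ 1 ∧ 0 < θ p t} ∪ {1})` and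
`J t := θ (pc t) t` the `let`-bound objects of the label-coupled anisotropic family on `ℤ²×ℤ`,
`TransportLemma → SupercritExchangeUniformity → SubcritExchangeUniformity → ModelFacts →
CriticalCurveRegular → Grimmett1999_criticalProb_pos_lt_one → ∀ lo hi, 0 < lo → lo < hi → hi < 1 →
∀ t ∈ [lo,hi], J t = J hi` — the INSTANTIATION of the abstract transport lemma: the critical jump
is constant on every compact sub-arc of the critical curve.

**The skeleton.** Once `ModelFacts` is unfolded the proof obligations are pure real analysis
(grounder g52-0 on the item: (a) glue the field, (b) shrink the collar into the open square,
(c) the threshold property for all real `p`), and the birth skeleton is exactly that cut, each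
piece stated ABSTRACTLY (percolation-free, over `ℝ`-valued families — the form a prover attacks
with Mathlib's order/topology library, and the form `TransportLemma` itself has):

* `stub_collar` — COMPACTNESS: a curve continuous on `[lo,hi]` with values in `(0,1)` keeps a
  uniform distance `ρ > 0` from `0` and `1` (its two-sided `ρ`-collar lies in the open square, a
  hypothesis of `TransportLemma`).  Size S–M (`IsCompact.exists_isMinOn` on `pc` and `1 − pc`).
* `stub_threshold` — SHARP THRESHOLD FROM THE `sInf` FORMULA, for EVERY real `p` (the crux's own
  "why it might fail": `sInf (S ∪ {1})`, `p < 0`, `p > 1`): for `θ(·,t) = ⨅ n, Θ n · t` with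
  `Θ n · t` nondecreasing and nonnegative and `0 < pc t < 1`, `⨅ n, Θ n p t = 0` below `pc t`
  and `> 0` above it — the threshold hypothesis of `TransportLemma`.  Size S–M
  (`csInf_le` / `exists_lt_of_csInf_lt` / `ciInf_mono`).
* `stub_gluedField` — the LOAD-BEARING stub, GLUING OF THE EXCHANGE-RATE FIELD across the curve:
  from K⁺ (field `a⁺` on the closed right collar: continuous, `L`-Lipschitz in `p`, exchange
  inequality `|Dt − a⁺·Dp| ≤ η·Dp` for `n ≥ m(η)`), K⁻ (continuous slope `σ` on the left
  `δ(η)`-strip), positivity `Dp n (pc t) t > 0` (`n ≥ 1`) and continuity of `pc`, produce ONE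
  field `a` continuous on the closed TWO-SIDED `ρ`-collar, Lipschitz on its right half, with the
  exchange inequality on `{pc t − δ(η) ≤ p ≤ pc t + ρ}` — the three field hypotheses of
  `TransportLemma`.  Key identity `a⁺ (pc t) t = σ t` (both inequalities at `p = pc t`, divide by
  `Dp > 0`, let `η ↓ 0`), then the pasting lemma on the two relatively closed halves of the
  collar.  Size M.  (Abstract over the derivative fields `Dt = ∂_tΘ_n`, `Dp = ∂_pΘ_n`.)
* `curveInvariance_core` (proved) — the percolation-free composition engine: the three stubs +
  `TransportLemma` + the `ModelFacts`/`CriticalCurveRegular`-type data over abstract `Θ, θ, pc`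
  ⇒ `θ (pc t) t = θ (pc hi) hi` on `[lo,hi]`.
* `CurveInvariance_of` (proved, kernel-checked, no `sorry`, axioms `propext`,
  `Classical.choice`, `Quot.sound`) — concludes the crux BY NAME: unfold, destructure
  `ModelFacts` / `CriticalCurveRegular`, read `Θ, θ, pc` off `ModelFacts` by unification
  (`hpc := fun _ => rfl`), apply the core.  The crux's sixth hypothesis
  `Grimmett1999_criticalProb_pos_lt_one` is not needed (`CriticalCurveRegular` already places
  the curve in the open square).

No stub alone gives the crux or the conjunct (each is a lemma of real analysis about arbitrary
real functions; BC3 probes `stub → CurveInvariance`, `stub → PercolationContinuityZ3` by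
`first | exact? | simpa [S] | (unfold S; simpa) | aesop` and by `first | exact? | simpa | aesop`
fail 12/12 — see `Lines/birth.md`), and all three are load-bearing in `curveInvariance_core`
(collar ⇒ the `ρ₀` fed to the gluing and the in-square clause; threshold ⇒ the phase clause;
glued field ⇒ the field clauses of `TransportLemma`).

Disproof / negatives honoured: `Cruxes/CurveInvariance/` had no workfiles before this one (no
`Disproof.lean`, no `_false_without_` theorem, no landed `Theorems/CurveInvariance/Negative/*`);
`ledger negatives --problem CriticalPhenomena` (11 entries; on this sub-problem TiltGluing,
CoverIsCovering, QuarantineInequality) has no statement about threshold curves, infima of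
monotone families or piecewise-continuous fields.  The refuters' typing points on the crux
(glued field continuous only where `∂_pΘ_n > 0`; K±'s collar/strip must fit the two-sided
`ρ`-collar after shrinking; threshold property for all real `p`) are exactly the three stubs'
hypotheses/conclusions.

Layout: §0 the three stub statements as name-keyed `Prop`s (`Sig.stub_*`) · §1 the registered
stubs `theorem stub_* : <spelled-out signature> := by sorry` (the only `sorry`s) · §2 the proved
core and the composition `CurveInvariance_of (h₁ : Sig.stub_collar) (h₂ : Sig.stub_threshold)
(h₃ : Sig.stub_gluedField) : …CurveInvariance` · §3 definitional consistency
(`*_registered : Sig.stub_* := stub_*`, and the crux from the registered stubs as an `example`).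
-/

namespace Summit.CriticalPhenomena.PercolationContinuityZ3.Cruxes.CurveInvariance.Birth

open Summit.CriticalPhenomena.PercolationContinuityZ3.Theses.PercExchangeRateTransport

/-! ## §0 The three stub statements, name-keyed (what `CurveInvariance_of` takes) -/

namespace Sig

/-- Name-keyed statement of `stub_collar`: a threshold curve continuous on the compact level
arc `[lo,hi]` with values in the open unit interval keeps a UNIFORM distance `ρ > 0` from `0` and
from `1` (so the two-sided `ρ`-collar of the curve lies inside the open square, as
`TransportLemma` requires). [stub statement; real analysis, compactness] -/
def stub_collar : Prop :=
  ∀ (pc : ℝ → ℝ) (lo hi : ℝ), lo ≤ hi → ContinuousOn pc (Set.Icc lo hi) →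
    (∀ t ∈ Set.Icc lo hi, 0 < pc t ∧ pc t < 1) →
    ∃ ρ > (0 : ℝ), ∀ t ∈ Set.Icc lo hi, ρ < pc t ∧ pc t + ρ < 1

/-- Name-keyed statement of `stub_threshold`: the SHARP-THRESHOLD property, for every real
`p`, of the critical value `pc t = sInf ({p | 0 ≤ p ≤ 1 ∧ 0 < θ p t} ∪ {1})` of a level `t`,
when `θ(·,t) = ⨅ n, Θ n · t` is the infimum of a family nondecreasing in `p` and nonnegative and
`0 < pc t < 1`: `θ = 0` strictly below `pc t` (including `p < 0`) and `θ > 0` strictly above it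
(including `p > 1`). [stub statement; real analysis, order] -/
def stub_threshold : Prop :=
  ∀ (Θ : ℕ → ℝ → ℝ → ℝ) (θ : ℝ → ℝ → ℝ) (pc : ℝ → ℝ) (t : ℝ),
    (∀ n, Monotone (fun p => Θ n p t)) → (∀ n p, 0 ≤ Θ n p t) →
    (∀ p, θ p t = ⨅ n, Θ n p t) →
    pc t = sInf ({p : ℝ | 0 ≤ p ∧ p ≤ 1 ∧ 0 < θ p t} ∪ {1}) →
    0 < pc t → pc t < 1 →
    ∀ p : ℝ, (p < pc t → (⨅ n, Θ n p t) = 0) ∧ (pc t < p → 0 < ⨅ n, Θ n p t)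

/-- Name-keyed statement of `stub_gluedField`: GLUING OF THE EXCHANGE-RATE FIELD across the
critical curve.  Abstract over the two derivative fields `Dt n p t` (`= ∂_tΘ_n`) and `Dp n p t`
(`= ∂_pΘ_n`), a curve `pc` continuous on `[lo,hi]` whose `ρ₀`-collar lies in the open square, and
positivity of `Dp n (pc t) t` for `n ≥ 1`: the supercritical datum K⁺ (field `a⁺` continuous on
the closed right `ρ⁺`-collar, `L`-Lipschitz in `p`, exchange inequality
`|Dt − a⁺·Dp| ≤ η·Dp` for `n ≥ m(η)` on the right collar) and the subcritical datum K⁻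
(continuous slope `σ` on `[lo,hi]`, exchange inequality `|Dt − σ·Dp| ≤ η·Dp` for `n ≥ m(η)` on the
left `δ(η)`-strip) produce ONE field `a`, continuous on the closed TWO-SIDED `ρ`-collar
(`ρ ≤ ρ₀`), `L`-Lipschitz in `p` on its right half, with the exchange inequality on
`{pc t − δ(η) ≤ p ≤ pc t + ρ}` — exactly the field hypotheses of `TransportLemma`.  (Content:
`a := a⁺` on/above the curve, `σ t` below; continuity across the curve needs
`a⁺ (pc t) t = σ t`, forced by the two inequalities at `p = pc t` and `Dp > 0`; then pasting of
two relatively closed pieces.) [stub statement; real analysis, the load-bearing stub] -/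
def stub_gluedField : Prop :=
  ∀ (Dt Dp : ℕ → ℝ → ℝ → ℝ) (pc : ℝ → ℝ) (lo hi ρ₀ : ℝ),
    lo ≤ hi → 0 < ρ₀ → ContinuousOn pc (Set.Icc lo hi) →
    (∀ t ∈ Set.Icc lo hi, ρ₀ < pc t ∧ pc t + ρ₀ < 1) →
    (∀ t ∈ Set.Icc lo hi, ∀ n : ℕ, 1 ≤ n → 0 < Dp n (pc t) t) →
    (∃ ρ > (0 : ℝ), ∃ L : ℝ, ∃ a : ℝ → ℝ → ℝ,
      ContinuousOn (fun x : ℝ × ℝ => a x.1 x.2)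
          {x : ℝ × ℝ | x.2 ∈ Set.Icc lo hi ∧ pc x.2 ≤ x.1 ∧ x.1 ≤ pc x.2 + ρ} ∧
        (∀ t ∈ Set.Icc lo hi, ∀ p q : ℝ, pc t ≤ p → p ≤ pc t + ρ → pc t ≤ q → q ≤ pc t + ρ →
          |a p t - a q t| ≤ L * |p - q|) ∧
        ∀ η > (0 : ℝ), ∃ m : ℕ, ∀ n ≥ m, ∀ t ∈ Set.Icc lo hi, ∀ p : ℝ, pc t ≤ p → p ≤ pc t + ρ →
          |Dt n p t - a p t * Dp n p t| ≤ η * Dp n p t) →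
    (∃ σ : ℝ → ℝ, ContinuousOn σ (Set.Icc lo hi) ∧
        ∀ η > (0 : ℝ), ∃ δ > (0 : ℝ), ∃ m : ℕ, ∀ n ≥ m, ∀ t ∈ Set.Icc lo hi, ∀ p : ℝ,
          pc t - δ ≤ p → p ≤ pc t → |Dt n p t - σ t * Dp n p t| ≤ η * Dp n p t) →
    ∃ ρ > (0 : ℝ), ∃ L : ℝ, ∃ a : ℝ → ℝ → ℝ, ρ ≤ ρ₀ ∧
      ContinuousOn (fun x : ℝ × ℝ => a x.1 x.2)
          {x : ℝ × ℝ | x.2 ∈ Set.Icc lo hi ∧ |x.1 - pc x.2| ≤ ρ} ∧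
        (∀ t ∈ Set.Icc lo hi, ∀ p q : ℝ, pc t ≤ p → p ≤ pc t + ρ → pc t ≤ q → q ≤ pc t + ρ →
          |a p t - a q t| ≤ L * |p - q|) ∧
        ∀ η > (0 : ℝ), ∃ δ > (0 : ℝ), ∃ m : ℕ, ∀ n ≥ m, ∀ t ∈ Set.Icc lo hi, ∀ p : ℝ,
          pc t - δ ≤ p → p ≤ pc t + ρ → |Dt n p t - a p t * Dp n p t| ≤ η * Dp n p t

end Sig

/-! ## §1 Registered stubs (the only `sorry`s of the file) -/

/-- **Stub 1 — COLLAR INSIDE THE SQUARE (compactness).** A curve `pc` continuous on `[lo,hi]`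
with `0 < pc t < 1` there is uniformly inside: `∃ ρ > 0, ∀ t ∈ [lo,hi], ρ < pc t ∧ pc t + ρ < 1`
(minimum of the continuous positive functions `pc`, `1 − pc` on a compact set). -/
theorem stub_collar :
    ∀ (pc : ℝ → ℝ) (lo hi : ℝ), lo ≤ hi → ContinuousOn pc (Set.Icc lo hi) →
      (∀ t ∈ Set.Icc lo hi, 0 < pc t ∧ pc t < 1) →
      ∃ ρ > (0 : ℝ), ∀ t ∈ Set.Icc lo hi, ρ < pc t ∧ pc t + ρ < 1 := by
  sorry

/-- **Stub 2 — SHARP THRESHOLD FROM THE `sInf` DEFINITION (all real `p`).** For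
`θ(·,t) = ⨅ n, Θ n · t` with each `Θ n · t` nondecreasing and nonnegative, and
`pc t = sInf ({p | 0 ≤ p ≤ 1 ∧ 0 < θ p t} ∪ {1}) ∈ (0,1)`: `⨅ n, Θ n p t = 0` for `p < pc t` and
`0 < ⨅ n, Θ n p t` for `pc t < p` (the cases `p < 0`, `p > 1` are where `0 < pc t < 1` enter). -/
theorem stub_threshold :
    ∀ (Θ : ℕ → ℝ → ℝ → ℝ) (θ : ℝ → ℝ → ℝ) (pc : ℝ → ℝ) (t : ℝ),
      (∀ n, Monotone (fun p => Θ n p t)) → (∀ n p, 0 ≤ Θ n p t) →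
      (∀ p, θ p t = ⨅ n, Θ n p t) →
      pc t = sInf ({p : ℝ | 0 ≤ p ∧ p ≤ 1 ∧ 0 < θ p t} ∪ {1}) →
      0 < pc t → pc t < 1 →
      ∀ p : ℝ, (p < pc t → (⨅ n, Θ n p t) = 0) ∧ (pc t < p → 0 < ⨅ n, Θ n p t) := by
  sorry

/-- **Stub 3 — GLUED EXCHANGE-RATE FIELD (the load-bearing stub).** From K⁺ (right collar:
field `a⁺`, continuous, `L`-Lipschitz in `p`, exchange inequality for `n ≥ m(η)`) and K⁻ (left
`δ(η)`-strip: continuous slope `σ`), positivity of `Dp n (pc t) t` (`n ≥ 1`) and a curve `pc`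
continuous on `[lo,hi]` with its `ρ₀`-collar in the open square, build ONE field `a` continuous on
the closed two-sided `ρ`-collar (`0 < ρ ≤ ρ₀`), `L`-Lipschitz in `p` on the right half, with the
exchange inequality `|Dt − a·Dp| ≤ η·Dp` for `n ≥ m(η)` on `{pc t − δ(η) ≤ p ≤ pc t + ρ}`.
Key step: `a⁺ (pc t) t = σ t` (both inequalities hold at `p = pc t`, and `Dp > 0` there), so the
piecewise field `a := σ t` below the curve, `a⁺` on and above it, is continuous (pasting lemma on
the two relatively closed halves of the collar, `pc` continuous). -/
theorem stub_gluedField :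
    ∀ (Dt Dp : ℕ → ℝ → ℝ → ℝ) (pc : ℝ → ℝ) (lo hi ρ₀ : ℝ),
      lo ≤ hi → 0 < ρ₀ → ContinuousOn pc (Set.Icc lo hi) →
      (∀ t ∈ Set.Icc lo hi, ρ₀ < pc t ∧ pc t + ρ₀ < 1) →
      (∀ t ∈ Set.Icc lo hi, ∀ n : ℕ, 1 ≤ n → 0 < Dp n (pc t) t) →
      (∃ ρ > (0 : ℝ), ∃ L : ℝ, ∃ a : ℝ → ℝ → ℝ,
        ContinuousOn (fun x : ℝ × ℝ => a x.1 x.2)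
            {x : ℝ × ℝ | x.2 ∈ Set.Icc lo hi ∧ pc x.2 ≤ x.1 ∧ x.1 ≤ pc x.2 + ρ} ∧
          (∀ t ∈ Set.Icc lo hi, ∀ p q : ℝ, pc t ≤ p → p ≤ pc t + ρ → pc t ≤ q → q ≤ pc t + ρ →
            |a p t - a q t| ≤ L * |p - q|) ∧
          ∀ η > (0 : ℝ), ∃ m : ℕ, ∀ n ≥ m, ∀ t ∈ Set.Icc lo hi, ∀ p : ℝ, pc t ≤ p →
            p ≤ pc t + ρ → |Dt n p t - a p t * Dp n p t| ≤ η * Dp n p t) →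
      (∃ σ : ℝ → ℝ, ContinuousOn σ (Set.Icc lo hi) ∧
          ∀ η > (0 : ℝ), ∃ δ > (0 : ℝ), ∃ m : ℕ, ∀ n ≥ m, ∀ t ∈ Set.Icc lo hi, ∀ p : ℝ,
            pc t - δ ≤ p → p ≤ pc t → |Dt n p t - σ t * Dp n p t| ≤ η * Dp n p t) →
      ∃ ρ > (0 : ℝ), ∃ L : ℝ, ∃ a : ℝ → ℝ → ℝ, ρ ≤ ρ₀ ∧
        ContinuousOn (fun x : ℝ × ℝ => a x.1 x.2)
            {x : ℝ × ℝ | x.2 ∈ Set.Icc lo hi ∧ |x.1 - pc x.2| ≤ ρ} ∧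
          (∀ t ∈ Set.Icc lo hi, ∀ p q : ℝ, pc t ≤ p → p ≤ pc t + ρ → pc t ≤ q → q ≤ pc t + ρ →
            |a p t - a q t| ≤ L * |p - q|) ∧
          ∀ η > (0 : ℝ), ∃ δ > (0 : ℝ), ∃ m : ℕ, ∀ n ≥ m, ∀ t ∈ Set.Icc lo hi, ∀ p : ℝ,
            pc t - δ ≤ p → p ≤ pc t + ρ → |Dt n p t - a p t * Dp n p t| ≤ η * Dp n p t := by
  sorry

/-! ## §2 Composition (kernel-checked, no `sorry`): the three stubs give the crux by name -/

/-- The percolation-free core of the instantiation: for an abstract family `Θ n p t` with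
`θ = ⨅ n, Θ n`, threshold curve `pc` (the `sInf` formula), the `ModelFacts`-type regularity,
the `CriticalCurveRegular`-type continuity and bounds of `pc` on `(0,1)`, and the K⁺ / K⁻ data,
the three stubs and `TransportLemma` make `t ↦ θ (pc t) t` constant on every compact sub-arc. -/
theorem curveInvariance_core
    {Θ : ℕ → ℝ → ℝ → ℝ} {θ : ℝ → ℝ → ℝ} {pc : ℝ → ℝ}
    (hCollar : Sig.stub_collar) (hThr : Sig.stub_threshold) (hGlue : Sig.stub_gluedField)
    (hT : TransportLemma)
    (hinf : ∀ p t, θ p t = ⨅ n, Θ n p t)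
    (hpc : ∀ t, pc t = sInf ({p : ℝ | 0 ≤ p ∧ p ≤ 1 ∧ 0 < θ p t} ∪ {1}))
    (hC1 : ∀ n, ContDiffOn ℝ 1 (fun x : ℝ × ℝ => Θ n x.1 x.2) (Set.Ioo 0 1 ×ˢ Set.Ioo 0 1))
    (hmp : ∀ n t, Monotone (fun p => Θ n p t))
    (hmt : ∀ n p, Monotone (fun t => Θ n p t))
    (hanti : ∀ p t, Antitone (fun n => Θ n p t))
    (h01 : ∀ n p t, 0 ≤ Θ n p t ∧ Θ n p t ≤ 1)
    (hDpos : ∀ n, 1 ≤ n → ∀ p ∈ Set.Ioo (0 : ℝ) 1, ∀ t ∈ Set.Ioo (0 : ℝ) 1,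
      0 < deriv (fun q => Θ n q t) p)
    (hpcc : ContinuousOn pc (Set.Ioo 0 1))
    (hpcb : ∀ t ∈ Set.Ioo (0 : ℝ) 1, 0 < pc t ∧ pc t < 1)
    (hSup : ∀ lo hi : ℝ, 0 < lo → lo < hi → hi < 1 → ∃ ρ > (0 : ℝ), ∃ L : ℝ, ∃ a : ℝ → ℝ → ℝ,
      ContinuousOn (fun x : ℝ × ℝ => a x.1 x.2)
          {x : ℝ × ℝ | x.2 ∈ Set.Icc lo hi ∧ pc x.2 ≤ x.1 ∧ x.1 ≤ pc x.2 + ρ} ∧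
        (∀ t ∈ Set.Icc lo hi, ∀ p q : ℝ, pc t ≤ p → p ≤ pc t + ρ → pc t ≤ q → q ≤ pc t + ρ →
          |a p t - a q t| ≤ L * |p - q|) ∧
        ∀ η > (0 : ℝ), ∃ m : ℕ, ∀ n ≥ m, ∀ t ∈ Set.Icc lo hi, ∀ p : ℝ, pc t ≤ p →
          p ≤ pc t + ρ →
          |deriv (fun s => Θ n p s) t - a p t * deriv (fun q => Θ n q t) p| ≤
            η * deriv (fun q => Θ n q t) p)
    (hSub : ∀ lo hi : ℝ, 0 < lo → lo < hi → hi < 1 → ∃ σ : ℝ → ℝ,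
      ContinuousOn σ (Set.Icc lo hi) ∧
        ∀ η > (0 : ℝ), ∃ δ > (0 : ℝ), ∃ m : ℕ, ∀ n ≥ m, ∀ t ∈ Set.Icc lo hi, ∀ p : ℝ,
          pc t - δ ≤ p → p ≤ pc t →
          |deriv (fun s => Θ n p s) t - σ t * deriv (fun q => Θ n q t) p| ≤
            η * deriv (fun q => Θ n q t) p) :
    ∀ lo hi : ℝ, 0 < lo → lo < hi → hi < 1 → ∀ t ∈ Set.Icc lo hi, θ (pc t) t = θ (pc hi) hi := by
  intro lo hi hlo hlohi hhi t ht
  have hIcc : ∀ s ∈ Set.Icc lo hi, s ∈ Set.Ioo (0 : ℝ) 1 := fun s hs =>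
    ⟨hlo.trans_le hs.1, lt_of_le_of_lt hs.2 hhi⟩
  have hpcc' : ContinuousOn pc (Set.Icc lo hi) := hpcc.mono fun s hs => hIcc s hs
  have hpcb' : ∀ s ∈ Set.Icc lo hi, 0 < pc s ∧ pc s < 1 := fun s hs => hpcb s (hIcc s hs)
  obtain ⟨ρ₀, hρ₀, hρ₀b⟩ := hCollar pc lo hi hlohi.le hpcc' hpcb'
  have hpos : ∀ s ∈ Set.Icc lo hi, ∀ n : ℕ, 1 ≤ n → 0 < deriv (fun q => Θ n q s) (pc s) :=
    fun s hs n hn => hDpos n hn (pc s) (hpcb' s hs) s (hIcc s hs)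
  obtain ⟨ρ, hρ, L, a, hρle, hcont, hlip, hexch⟩ :=
    hGlue (fun n p t => deriv (fun s => Θ n p s) t) (fun n p t => deriv (fun q => Θ n q t) p)
      pc lo hi ρ₀ hlohi.le hρ₀ hpcc' hρ₀b hpos (hSup lo hi hlo hlohi hhi) (hSub lo hi hlo hlohi hhi)
  have hin : ∀ s ∈ Set.Icc lo hi, ρ < pc s ∧ pc s + ρ < 1 := fun s hs =>
    ⟨lt_of_le_of_lt hρle (hρ₀b s hs).1, by linarith [(hρ₀b s hs).2]⟩
  have hthr : ∀ s ∈ Set.Icc lo hi, ∀ p : ℝ,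
      (p < pc s → (⨅ n, Θ n p s) = 0) ∧ (pc s < p → 0 < ⨅ n, Θ n p s) := fun s hs =>
    hThr Θ θ pc s (fun n => hmp n s) (fun n p => (h01 n p s).1) (fun p => hinf p s) (hpc s)
      (hpcb' s hs).1 (hpcb' s hs).2
  have key := hT Θ pc a lo hi ρ L hlo hlohi hhi hρ hC1 hmp hmt hanti (fun n p t => (h01 n p t).1)
    hpcc' hin hthr hcont hlip hexch t ht
  rw [hinf, hinf]
  exact key

/-- **Composition.** The three registered stubs give the crux `CurveInvariance` BY NAME:
unfold the crux, read `Θ`, `θ`, `pc` off `ModelFacts` by unification, feed `TransportLemma`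
(hypothesis of the crux) with the glued field of `stub_gluedField` (on the collar of
`stub_collar`) and the threshold property of `stub_threshold`. Kernel-checked, no `sorry`. -/
theorem CurveInvariance_of (hCollar : Sig.stub_collar) (hThr : Sig.stub_threshold)
    (hGlue : Sig.stub_gluedField) :
    Summit.CriticalPhenomena.PercolationContinuityZ3.Theses.PercExchangeRateTransport.CurveInvariance := by
  intro hT hSup hSub hMF hCC _hPc
  obtain ⟨-, h2, h3, h4, h5, h6, h7, h8, -, -⟩ := hMF
  obtain ⟨hcc1, hcc2⟩ := hCC
  exact curveInvariance_core hCollar hThr hGlue hT h7 (fun _ => rfl) h2 h3 h4 h5 h6 h8 hcc1 hcc2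
    hSup hSub

/-! ## §3 Definitional consistency: the registered stubs feed the composition verbatim -/

/-- The registered stub 1, as spelled out, IS the name-keyed statement `Sig.stub_collar`. -/
theorem collar_registered : Sig.stub_collar := stub_collar

/-- The registered stub 2, as spelled out, IS the name-keyed statement `Sig.stub_threshold`. -/
theorem threshold_registered : Sig.stub_threshold := stub_threshold

/-- The registered stub 3, as spelled out, IS the name-keyed statement `Sig.stub_gluedField`. -/
theorem gluedField_registered : Sig.stub_gluedField := stub_gluedField

/- The crux from the three registered stubs (an `example`, so no `sorry`-tainted proof of the
crux enters the environment). -/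
example :
    Summit.CriticalPhenomena.PercolationContinuityZ3.Theses.PercExchangeRateTransport.CurveInvariance :=
  CurveInvariance_of stub_collar stub_threshold stub_gluedField

end Summit.CriticalPhenomena.PercolationContinuityZ3.Cruxes.CurveInvariance.Birth
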